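import Literature.NumberTheory.EllipticCurves.AnticyclotomicSignedSelmer
import HarnessLib

/-!
# Lei–Mastella–Zhao 2025 (after Matar 2021): in the Gross setting `y_K ∉ pE(K)` the signed
# Selmer groups `Sel^±(E/K_∞^{ac})` at a supersingular prime `p` ODD with `a_p = 0` are COFREE OF
# CORANK ONE over `Λ`, `corank_{ℤ_p} Sel_{p^∞}(E/K_n) = p^n`, `Ш(E/K_n)[p^∞]` is finite; under local
# primitivity at `v ∣ p` the BDP (relaxed–strict) Selmer group over `K_∞` VANISHES, `Sel_{p^∞}(E/K_n)
# ≅ (ℚ_p/ℤ_p)^{p^n}`, `X(E/K_∞)` is free of rank two and `Ш(E/K_n)[p^∞] = 0` — typed STATEMENTS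
# (cite-only named facts, hypotheses verbatim and read for `f = f_E`) + proved bridges

Topic `Literature/NumberTheory/EllipticCurves`; namespace `Literature.NumberTheory.EllipticCurves.AcSigned`
(joins the story of `AnticyclotomicSignedSelmer.lean` … `AnticyclotomicSignedSelmerFiniteIndex.lean`).
Cell `pub/bsd-wall` (BSD summit, rung W-ALL, row 2·3@3), literature-typer seat `bsd-wall-utd-ty1`
(g8; director-bsd g12 (142)(e): "type the `±` / signed anticyclotomic Selmer carriers at `p = 3` for
`a_p = 0` (Kobayashi 2003 §8; B.-D. Kim 2013/2014; Kitajima–Otsuki 2018; Matar RNT 2021; Castella–Wan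
2024 §4–5; HLV 2022)"), `--supports stmt-BirchSwinnertonDyer-23594`. HONEST FRAMING: two auxiliary
DEFINITIONS (hypothesis predicates, with bodies) + THREE statement-only named facts (`def … : Prop`,
D-0014; nothing is asserted, no `_holds`, no instance, no notation) + PROVED projections/bridges.
Typed ≠ proved ≠ endorsed; BSD is not advanced by this file.

## Why this file (the gap it fills)

The seat's earlier generations typed every carrier and structure theorem on the deciding chain and
left ONE printed gap flagged (`AnticyclotomicSignedSelmerFiniteIndex.lean`, flag `HLV-rank-one-input`):
"at `p = 3` NO print gives `Λ`-(co)rank one of `Sel^±(E/K_∞^{ac})` under (Heeg)" — Longo–Vigni 2019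
(`longoVigni2019_thm14_signedSelmerDual_rank_one`, `p ≥ 5`), Castella–Wan (`p > 3`), BBL 2022, LLM 2023
(`p ≥ 5`); Hatley–Lei–Vigni's Thm. 5.15 / 6.3 were therefore typed with the rank-one input as an
explicit binder `hrk`. Matar's two 2021 papers named in the seat text (Acta Arith. 201; Res. Number
Theory 7) are unobtainable (acq-13695, acq-13961: not on arXiv, author site certificate expired).
Lei–Mastella–Zhao 2025 — REFEREED (Res. Math. Sci., 2025), held as `paper:arxiv-2409.11966` (v1 LaTeX)
and read in the accepted arXiv v2 (29 pp.) — "generalizes earlier works of Matar and Matar–Nekovář on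
elliptic curves" (abstract) to even-weight newforms, "uniformly [in] the ordinary and non-ordinary
settings", with hypotheses displayed for an ODD prime `p`: its Appendix A (Theorem B, "modeled on that of
Matar [Mat21a]") proves, for `a_p(f) = 0` and `p ∤ 2(k−1)!Nφ(N)h_K`, that `Sel^+(K_∞, A)` and
`Sel^−(K_∞, A)` are COFREE OF CORANK ONE over `Λ`. At `k = 2` the standing condition reads
`p ∤ 2Nφ(N)h_K`, so `p = 3` IS ADMISSIBLE (whenever `3 ∤ N φ(N) h_K`): the first refereed print giving
`X^± ≅ Λ` at `p = 3` — in the Gross setting (`y_K ∉ pE(K)`, `Ш(E/K)[p^∞] = 0`), where it discharges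
the `hrk` binder of `hatleyLeiVigni2022_thm515_noFiniteIndex` BY SHAPE (`leiMastellaZhao2025_thmB.hrk`
below). Kleine–Matar–Ramdorai 2026 (arXiv:2601.08612, held) Thm. 2.11 restates Matar's Acta Arith.
theorem in the elliptic-curve vocabulary used here ("Assume `y_K ∉ pE(K)`, `p ∤ ∏_{v∣N} c_v`. Then both
`X^{++}(E/K_{ac})` and `X^{−−}(E/K_{ac})` are free `Λ`-modules of rank one. Proof. See [Matar_Tower]"),
under THEIR standing `p ≥ 5` — it is the secondary locator for the `E`-dictionary below, not a `p = 3`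
source.

## Sources, VERBATIM (texts read by this seat 2026-08-28; locators = arXiv:2409.11966v2, the accepted
version, 29 pp.; labels as printed there)

* [LeiMastellaZhao2025] A. Lei, L. Mastella, L. Zhao, *On the structure of the Bloch–Kato Selmer
  groups of modular forms over anticyclotomic `ℤ_p`-towers*, Res. Math. Sci. (2025),
  doi:10.1007/s40687-025-00589-5 (= arXiv:2409.11966v2). §1.1: "Fix once and for all a prime number
  `p > 2` … `f` … newform of even weight `k ≥ 2` and level `Γ₀(N)` … `𝔽 = ℚ_p(a_n(f))`, `𝒪`, `ϖ` …
  `V = V_f(k/2)` … lattice `T ⊂ V` [Nekovář] … `A = V/T`. Let `K` be an imaginary quadratic field of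
  discriminant `d_K ≠ −3, −4` coprime to `Np` … (Heeg.) `N⁻` is a squarefree product of an even number
  of primes … We will assume `p ∤ h_K`, so that both places above `p` in `K` are totally ramified in
  `K_∞/K` … `Γ = Gal(K_∞/K)` and `Λ = 𝒪⟦Γ⟧`." §2 (p. 4): "From now on, we will always assume that `p`
  splits in `K` and `p ∤ 2(k−2)!Nφ(N)h_K`"; the `(□,△)`-Selmer groups `Sel^{□,△}(K_n, A)`,
  `□, △ ∈ {∅ (relaxed), 0 (strict), f}`, "`Sel^{∅,0}(K_n, A)` the BDP-Selmer group", "`Sel^{□,△}(K_∞, A) =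
  lim→_n Sel^{□,△}(K_n, A)`". §3: Def. 3.3 "`Ш_BK(E, A) = Sel(E, A)/Sel(E, A)_div`. Note in particular
  that, for any finite extension `E/K`, the group `Ш_BK(E; A)` is finite"; Def. 3.5 (`Λ̃(K_n)`, the
  Abel–Jacobi image; "`Ш_AJ(K_n, A) = Sel(K_n, A)/Λ̃(K_n) ⊗_𝒪 𝔽/𝒪`"). §4: "(Tors.) if `f` has weight 2
  and is `p`-ordinary, then `a_p ≢ 1 (mod ϖ)`; (Tama.) for any place `w ∣ N` of `K`, `p ∤ b_w`", where
  "`B_w = A^{G_{K_∞,w'}}/(A^{G_{K_∞,w'}})_div` … since `B_w` is a `p`-group, `p ∤ b_w` if and only if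
  `B_w = 0`, namely `A^{G_{K_∞,w'}}` is divisible"; Prop. 4.2 (control). §5: "(Loc.prim.)
  `loc_v(z_{f,K}) ∉ ϖH¹_f(K_v, T)`; (Sel.) `Sel(K, A) = 𝔽/𝒪 · z_{f,K}`"; **Prop. 5.1** "Assume (Tors.),
  (Tama.), (Loc.prim.) and (Sel.). For all `n ∈ ℤ_{≥0} ∪ {∞}`, `Sel^{BDP}(K_n, A) = 0`"; Remark 5.2
  ("our proof works with `v, v̄` switched under the same set of assumptions"); **Cor. 5.4** ("for all
  `n ∈ ℤ_{≥0}`, the map `Sel(K_n, A) → H¹_f(K_{n,w}, A)` is an isomorphism for `w ∣ p`. Consequently, (1)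
  `corank_𝒪(Sel(K_n; A)) = p^n`; (2) … `Ш_BK(K_n; A) = Sel(K_n; A)/Sel(K_n; A)_div = 0`"); §6 Thm. 6.2.
  **Theorem A** (§1.3 = Prop. 5.1 + Cor. 5.4 + Thm. 6.2) and **Theorem B** (App. A §A.1) — quoted at the
  facts below; **Remark A.1** (4): "Note that if `k = 2`, then the conditions on `α₁, α₂` are superfluous
  as `α₀ = −2z_{f,K} ∉ pH¹(K, T)`"; (5): "(vi) actually asserts that `z_{f,K}` is a generator of
  `Sel(K, A)`, namely, the map `𝔽/𝒪 → Sel(K, A)` sending `t` to `z_{f,K} ⊗ t` is an isomorphism"; §A.2.1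
  "Throughout the appendix, we assume `p ∤ 2Nφ(N)(k−1)!h_K`, `p` splits in `K` and `a_p(f) = 0`";
  §A.2.3–A.2.4: "`H¹_±(K_∞,w, T) = ker(Col^±)`, … `H¹_±(K_∞,w, A)` its orthogonal complement under the
  local Tate pairing; … `H¹_±(K_n,w, A) = H¹_±(K_∞,w, A)^{Γ_n}`"; Lemma A.4 [Lei10]: "`H¹_ε(K_n,w, A)`
  coincides with `{z ∈ H¹_f(K_n,w, A) : cores_{K_n/K_{m+1}}(z) ∈ H¹(K_m,v, A)` for all `m ∈ ℤ_{≥0}`,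
  `m < n`, `(−1)^m = ε`}"; "`Sel^±(K_n, A) = ker(H¹(K_n, A) → ∏_{w∣p} H¹(K_n,w, A)/H¹_±(K_n,w, A) ×
  ∏_{w∤p} H¹(K_n,w, A)/H¹_f(K_n,w, A))`" for `n ∈ ℤ_{≥0} ∪ {∞}`; Remark A.8 "`Sel^±(K, A) = Sel(K, A)`";
  Prop. A.9 (control, under (Tama.)); Prop. A.13, Cor. A.14 (non-torsion), Prop. A.15 (lower bound),
  **Prop. A.16** "Assume (Tama.), (Sel.) and (Inc.) hold. The `Λ`-modules `X^±_∞` are free of rank 1",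
  Lemma A.17 [Kob03]; §A.4 "Proof of Theorem B".
* [KleineMatarRamdorai2026] S. Kleine, A. Matar, S. Ramdorai, arXiv:2601.08612 (`paper:arxiv-2601.08612`),
  applications §2.2 ("Root number −1"): standing "`p ≥ 5`", `E/ℚ` good supersingular at `p`, `p` split
  in `K`, `K ≠ ℚ(√−1), ℚ(√−3)`, `p ∤ h_K`, "the Heegner hypothesis: Every prime dividing `N` splits in
  `K/ℚ`", `y_K` the trace to `K` of the Heegner point of a parametrisation `X₀(N) → E`; Def. 2.4
  (`H¹_{𝓛_v}(K_{n,v}, E[p^∞]) = E^±(K_{n,v}) ⊗ ℚ_p/ℤ_p` for `𝓛_v = ±`; `Sel^𝓛(E/K_{ac}) = lim→`);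
  **Thm. 2.11** "Assume the following: `y_K ∉ pE(K)`; `p ∤ ∏_{v∣N} c_v`. Then both `X^{++}(E/K_{ac})` and
  `X^{−−}(E/K_{ac})` are free `Λ`-modules of rank one. Proof. See [Matar_Tower]" (= [Matar2021ActaArith]).
* [Matar2021ActaArith] A. Matar, Acta Arith. 201 (2021) 131–147; [Matar2021RNT] A. Matar, Res. Number
  Theory 7 (2021) no. 3, Paper 43 — the originals LMZ generalise (LMZ §1.2: "Matar [Mat21a; Mat21b]
  extended the results of [MN19] to show that the `p`-primary Shafarevich–Tate groups of `E` in the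
  anticyclotomic `ℤ_p`-tower are once again trivial, whereas the Pontryagin dual of `Sel_{p^∞}(E/K_∞)` is
  a free `Λ`-module of rank two"). TEXTS NOT HELD (acq-13695, acq-13961); cited, never quoted.

## The `E`-dictionary (READING FLAGS — where the transcription is a reading, not a printed sentence)

The facts are LMZ's Theorems A and B READ FOR `f = f_E`, the weight-2 newform of an elliptic curve
`E/ℚ` of conductor `N` (modularity; the parametrisation is part of `IsHeegnerPoint`), `k = 2`, `𝔽 = ℚ_p`,
`𝒪 = ℤ_p`, `ϖ = p`, hypothesis (vii) "`p` unramified in `𝔽`" void: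

* `LMZ-T`: `T ↔ T_p E`, `A ↔ E[p^∞]`: at a good supersingular prime `E[p]|_{G_{ℚ_p}}` is irreducible,
  so all `G_ℚ`-stable lattices in `V_p E ≅ V_f(1)` are homothetic and every curve in the isogeny class
  has the same `T_p` and `E[p^∞]` (isogeny degrees prime to `p`); `H¹_f(K_{n,w}, E[p^∞]) =
  E(K_{n,w}) ⊗ ℚ_p/ℤ_p` [BK90, Ex. 3.11], `= 0` for `w ∤ p`; hence LMZ's `Sel(K_n, A)` is the tree's
  `Sel_{p^∞}(E/K_n)` (`WeierstrassCurve.selmerGroupPInfty`, `selmerCorank`) and `Ш_AJ(K_n, A) =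
  Sel(K_n, A)/Λ̃(K_n) ⊗ ℚ_p/ℤ_p` is `Sel_{p^∞}(E/K_n)/(E(K_n) ⊗ ℚ_p/ℤ_p) = Ш(E/K_n)[p^∞]` (for `k = 2` the
  Abel–Jacobi map on `CH¹(X)_0` is the Kummer map; `Gal(K[p^{n+1}]/K_n)` has order `h_K(p−1)` prime to
  `p`, and tensoring with `ℚ_p/ℤ_p` ignores finite index), while `Ш_BK(K_n, A) = Sel/Sel_div` is
  `Ш(E/K_n)[p^∞]/div`: "(III) `Ш_BK = Ш_AJ`, in particular `Ш_AJ` finite" reads "`Ш(E/K_n)[p^∞]` is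
  finite" (`LayerShaPrimaryFinite`), "(V) `Ш_AJ(K_n, A) = 0`" reads "`Ш(E/K_n)[p^∞] = 0`"
  (`LayerShaPrimaryTrivial`; finite `n` only — weaker than print), "(2) `Sel(K_n, A) ≃ (𝔽/𝒪)^{⊕p^n}`"
  reads "`corank_{ℤ_p} = p^n` and `Sel_{p^∞}(E/K_n)` divisible" (`LayerSelmerDivisible`).
* `LMZ-z`: `z_{f,K} ↔ κ(y_K)`. Hypotheses (v)/(v')/(vi) are placed on a classical Heegner point
  `y_K = P ∈ E(K)` of level `N` (`IsHeegnerPoint N W K P`: trace to `K` of the Heegner point of a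
  modular parametrisation, as in Matar's originals and KMR26 Thm. 2.11), through the elementary
  equivalences (valid as `E(K)[p] = 0 = E(K_v)[p]` in the `Setting`, `iovitaPollack2006_lemma21…`,
  `bdKim2013_prop32…`): (Loc.prim.) `loc_v κ(P) ∉ pH¹_f(K_v, T_pE) = p·E(K_v)^∧` ⟺ `P ∉ pE(K_v)`
  (`HeegnerPointLocallyIndivisible`); (v') `κ(P) ∉ pH¹(K, T_pE)` ⟺ `P ∉ pE(K)` (`E(K) ⊗ ℤ_p` is
  saturated in `H¹(K, T_pE)`, the cokernel `T_p H¹(K, E)` being torsion-free); (Sel.) "`Sel(K, A) =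
  (ℚ_p/ℤ_p)·κ(P)`" ⟺ "`rank_ℤ E(K) = 1` and `Ш(E/K)[p^∞] = 0`" (from `0 → E(K) ⊗ ℚ_p/ℤ_p → Sel_{p^∞}(E/K)
  → Ш(E/K)[p^∞] → 0`, divisibility of `ℚ_p/ℤ_p`, and `P` non-torsion, which (Loc.prim.)/(v') force).
  For THEOREM A this dictionary is COVERED BY PRINT: LMZ (v2, after Remark 1.1) "the proof of Theorem A
  in §5 and §6 does not employ the generalized Heegner class in an essential way. Rather, we rely on the
  existence of a cohomology class `z ∈ H¹_f(K, T)` for which the conditions given by hypotheses (v) and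
  (vi) above are met … Theorem A holds when `z_{f,K}` is replaced by the classical Heegner class". For
  THEOREM B (whose proof uses the tower classes `α_n = cores_{K[p^{n+1}]/K_n}(z_{f,p^{n+1}})` and their
  norm relations (H1)–(H3) [LV19a, Lemma 4.1], i.e. for `E` the Heegner points of conductor `p^{n+1}` of
  Perrin-Riou 1987 / the tree's `HeegnerFamily`) it is a READING: LMZ's `z_{f,K}` is Castella–Hsieh's
  class, which for `k = 2` and the trivial character is the Kummer image of a Heegner point (Remark A.1
  (4): `α₀ = −2 z_{f,K}`); the comparison constant with `κ(y_K)` on a given curve of the isogeny class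
  involves only isogeny degrees (prime to `p`: `E[p]` irreducible), the Manin constant (`p ∤ N`), `u_K =
  1` (`d_K ≠ −3, −4`), the factor `2` and `deg(X₁(N) → X₀(N)) = φ(N)/2` (`p ∤ 2φ(N)` by (ii')) — recorded
  here, NOT formalised; Matar's original [Matar2021ActaArith] (KMR26 Thm. 2.11) is stated for `y_K`.
* `LMZ-local-condition`: LMZ DEFINE `H¹_±(K_∞,w, A)` as the orthogonal complement of `ker Col^±`
  (Lei's signed Coleman maps) and PROVE (Lemma A.4, after [Lei10]) the trace description inside
  `H¹_f = E(K_{n,w}) ⊗ ℚ_p/ℤ_p`; KMR26 Def. 2.4 and the tree (`Kobayashi2003.signedSelmerInfty`, flag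
  `CW24-local-condition` of `AnticyclotomicSignedSelmer.lean`) use Kobayashi's `E^±(K_{n,w}) ⊗ ℚ_p/ℤ_p`.
  The facts are stated, like `longoVigni2019_thm14_signedSelmerDual_rank_one` and the HLV facts, on the
  tree's Pontryagin-dual datum `Kobayashi2003.SignedSelmerDualData (W⁄K) κ γ ε` (same sign `ε` at both
  primes above `p`, as LMZ's `Sel^+`, `Sel^−` and KMR's `X^{++}`, `X^{−−}`).
* `away-p` (as in `AnticyclotomicSignedSelmer.lean`): LMZ impose `H¹_f` (= `0` for `E[p^∞]`, `w ∤ p`)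
  at `w ∣ N` and unramifiedness outside `Σ = {ℓ ∣ N} ∪ {p, ∞}`; over `K_∞` the unramified classes at a
  good `w ∤ p` are trivial (`E[p^∞]/(Frob^{p^m} − 1) = 0`), so `Sel^{∅,0}(K_∞, A)` is the tree's
  `selmer (W⁄K) p κ ∅ (PCond.at 𝔭̄ .str .rel)` (STRICT at every `v ∤ p`: `Σ`-parameter `∅`) =
  `Castella2018.AcSelmer.selmerAc (W⁄K) p κ 𝔭̄ ∅` (`selmer_at_str_rel_eq_selmerAc`).
* `n = ∞ only`: Prop. 5.1 / Thm. A (1) is printed for all `n ∈ ℤ_{≥0} ∪ {∞}`; only `n = ∞` is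
  transcribed (the tree has no finite-layer BDP-Selmer carrier); (V) only for finite `n`.
* `coprime-disc`: "coprime-to-`Np` discriminant" is implied by the binders (every prime dividing `N`
  splits in `K` — `SatisfiesHeegnerHypothesis` — and `p` splits — `Setting.ne` —, hence none ramifies)
  and is not repeated; `d_K ≠ −3, −4` is carried verbatim.
* `tot-ram-via-h_K`, `Shapiro`: as in `AnticyclotomicSignedSelmer.lean`.

## NOT in this file (and why)

* Theorem A for `p`-ORDINARY `f` (conclusion (3): rank ONE; hypothesis (Tors.)): the `Setting` of this
  story is `a_p = 0`; the ordinary Gross setting is `MatarNekovar2019/*` in the tree.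
* LMZ Thm. 3.1 (higher-weight Kolyvagin–Gross: `Sel(K, A) = (𝔽/𝒪) z_{f,K}` under big image), Prop. 3.6,
  Cor. 3.7, Thm. 6.2 (universal norms: `H¹_Iw(K_{∞,w}, T)` free of rank two; `lim← H¹_f = 0` in the
  non-ordinary case), Prop. 4.2 / A.9 (control), Prop. A.13–A.15 (Heegner modules `ℋ_n ≅
  Λ_𝔽/(ω_n^{ε(n)})`, non-torsion, `corank ≥ p^n`): intermediate results, not consumer-facing here.
* Higher weight (`k > 2`, Bloch–Kato Selmer groups of modular forms): no carrier, no consumer.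
* For `E` the hypothesis (Sel.) FOLLOWS from (v') by Kolyvagin–Gross in Matar–Nekovář's form
  (`MatarNekovar2019.thm67_sha_primary_trivial_of_irreducible`: `p ≠ 2`, `E[p]` irreducible, `(K, p) ≠
  (ℚ(√−3), 3)`, `y_K ∉ pE(K)` ⟹ `Ш(E/K)[p^∞] = 0`; the printed clause `E(K) ⊗ ℤ_p = ℤ_p y_K` is not
  transcribed there) — it is nevertheless CARRIED as printed (binders `hrk`, `hSha`), not discharged.
-/

noncomputable section

open scoped Classical

open NumberField IsDedekindDomain Field
open Literature.NumberTheory.EllipticCurves Literature.NumberTheory.GaloisRepresentations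
open Literature.NumberTheory.EllipticCurves.GreenbergSelmer
open Literature.NumberTheory.EllipticCurves.Kobayashi2003

namespace Literature.NumberTheory.EllipticCurves.AcSigned

/-! ## Part 1. The hypotheses and the layer-wise conclusions, read for `E` (definitions) -/

section Hypotheses

variable (W : WeierstrassCurve ℚ) (K : Type) [Field K] [NumberField K] (p : ℕ) [Fact p.Prime]
  (κ : ZpExtension K p)

/-- **LMZ hypothesis (Tama.) = (iv), read for `E`: for every place `w ∣ N` of `K` and every place
`w' ∣ w` of `K_∞`, the group `A^{G_{K_∞,w'}} = E(K_{∞,w'})[p^∞]` is DIVISIBLE.** Printed (§4): "Given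
`w ∤ p` a place of `K`, let `w' ∣ w` be a place of `K_∞`, and write `G_{K_∞,w'}` for the decomposition
group of `w'` in `G_{K_∞}`. Define `B_w = A^{G_{K_∞,w'}}/(A^{G_{K_∞,w'}})_div`; note that `b_w = |B_w|`
depends on `w` and not on `w'` … since `B_w` is a `p`-group, `p ∤ b_w` if and only if `B_w = 0`, namely
`A^{G_{K_∞,w'}}` is divisible … (Tama.) for any place `w ∣ N` of `K`, `p ∤ b_w`"; Theorems A/B (iv): "for
any `w ∣ N` in `K` and any `w' ∣ w` in `K_∞`, the group `A^{G_{K_∞,w'}}` is divisible" ("a higher-weight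
variant of the `p`-freeness of Tamagawa numbers", Remark 1.1). Transcribed on the local tower groups of
`AnticyclotomicSignedSelmer.lean`: `E(K_∞·K_v) = localPointsInfty κ ι (W⁄K)` at the chosen embedding
`ι = closureEmb` of the completion `K_v` (`b_w` does not depend on the place above `w`), for every finite
place `v` with `N ∈ v`; "divisible" for the `p`-primary torsion subgroup = `p`-divisible inside
`E(K_∞·K_v)` (a `p`-power torsion point divided by `p` stays `p`-power torsion).
[cite: LeiMastellaZhao2025, §4 hypothesis (Tama.) and Thm. A/B (iv) (arXiv:2409.11966v2 pp. 2, 10, 18)] -/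
def LocalTorsionDivisibleAtBad (N : ℕ) : Prop :=
  ∀ v : HeightOneSpectrum (𝓞 K), ((N : ℕ) : 𝓞 K) ∈ v.asIdeal →
    ∀ P : localPoints (W.baseChange K) (v.adicCompletion K),
      P ∈ localPointsInfty κ (closureEmb (K := K) (v.adicCompletion K)) (W.baseChange K) →
      (∃ k : ℕ, p ^ k • P = 0) →
        ∃ Q ∈ localPointsInfty κ (closureEmb (K := K) (v.adicCompletion K)) (W.baseChange K),
          p • Q = P

/-- **LMZ hypothesis (Loc.prim.) = Thm. A (v) / the extra hypothesis of Thm. B (IV)–(V), read for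
`E`: the Heegner point is not divisible by `p` in `E(K_v)`, `v` the chosen prime above `p`.** Printed
(§5): "(Loc.prim.) `loc_v(z_{f,K}) ∉ ϖH¹_f(K_v, T)`"; Thm. A (v): "the class `z_{f,K}` is locally
primitive at `v`, i.e., its restriction `loc_v(z_{f,K}) ∈ H¹_f(K_v, T)` is not in `ϖH¹_f(K_v, T)`";
Remark 1.1: "analogous to the assumption that the Heegner point `y_K` of an elliptic curve `E` satisfies
`y_K ∉ pE(K_v)` in [Mat21a]" (KMR26 Thm. 2.9/2.12: "`y_K ∉ pE(K_v)` for some prime `v` above `p`"; their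
Lemma 2.7: `y_K ∉ pE(K_𝔭) ⟺ y_K ∉ pE(K_𝔭̄)`). For `k = 2`, `H¹_f(K_v, T_pE) = E(K_v) ⊗ ℤ_p` and
`E(K_v)[p] = 0` (`bdKim2013_prop32_localPoints_noPTorsion`), so the condition is `P ∉ pE(K_v)` (flag
`LMZ-z`). Transcribed on the `K_v`-rational points of the model (`K_v = v.adicCompletion K`, the image
of `P` under `Affine.Point.map` along `K → K_v`).
[cite: LeiMastellaZhao2025, §5 (Loc.prim.), Thm. A (v), Remark 1.1 (arXiv:2409.11966v2 pp. 2–3, 13)]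
[cite: KleineMatarRamdorai2026, Lemma 2.7 and Thm. 2.12 (a) (arXiv:2601.08612, applications §2.2)] -/
def HeegnerPointLocallyIndivisible (v : HeightOneSpectrum (𝓞 K))
    (P : (W.baseChange K).toAffine.Point) : Prop :=
  ¬ ∃ Q : (W.baseChange (v.adicCompletion K)).toAffine.Point,
      p • Q = WeierstrassCurve.Affine.Point.map (algebraMap K (v.adicCompletion K)).toRatAlgHom P

/-- **"`corank_𝒪(Sel(K_n, A)) = r`" read for `E`: `corank_{ℤ_p} Sel_{p^∞}(E/K_n) = r`** at the layer
`K_n = κ.layer n` (a number field: finite over `K`, `ZpExtension.finiteDimensional_layer_holds`), in the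
tree's `WeierstrassCurve.selmerCorank` (flag `LMZ-T`). LMZ Thm. A (2) / Cor. 5.4 (1) / Thm. B (II).
[cite: LeiMastellaZhao2025, Cor. 5.4 (1) and Thm. B (II) (arXiv:2409.11966v2 pp. 15, 18)] -/
def LayerSelmerCorankEq (n r : ℕ) : Prop :=
  haveI : FiniteDimensional K (κ.layer n) := κ.finiteDimensional_layer_holds n
  haveI : NumberField (κ.layer n) := NumberField.of_module_finite K (κ.layer n)
  (W.baseChange (κ.layer n)).selmerCorank p = r

/-- **"`Sel(K_n, A)` is divisible" read for `E`: `Sel_{p^∞}(E/K_n)` is `p`-divisible** (with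
`LayerSelmerCorankEq … n (p^n)` this is LMZ's "`Sel(K_n, A) ≃ (𝔽/𝒪)^{⊕p^n}`", Thm. A (2), and Cor. 5.4
(2) "`Ш_BK(K_n; A) = Sel(K_n; A)/Sel(K_n; A)_div = 0`"), on the tree's `Sel_{p^∞}(E/K_n) =
WeierstrassCurve.selmerGroupPInfty` (flag `LMZ-T`).
[cite: LeiMastellaZhao2025, Thm. A (2) and Cor. 5.4 (2) (arXiv:2409.11966v2 pp. 2, 15)] -/
def LayerSelmerDivisible (n : ℕ) : Prop :=
  haveI : FiniteDimensional K (κ.layer n) := κ.finiteDimensional_layer_holds n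
  haveI : NumberField (κ.layer n) := NumberField.of_module_finite K (κ.layer n)
  ∀ c ∈ (W.baseChange (κ.layer n)).selmerGroupPInfty p,
    ∃ c' ∈ (W.baseChange (κ.layer n)).selmerGroupPInfty p, p • c' = c

/-- **"`Ш_AJ(K_n, A)` is finite" read for `E`: `Ш(E/K_n)[p^∞]` is finite** (LMZ Thm. B (III): "the
Shafarevich–Tate groups `Ш_BK(K_n, A)` and `Ш_AJ(K_n, A)` introduced in §3 coincide. In particular,
`Ш_AJ(K_n, A)` is finite for all `n ≥ 0`"; Def. 3.3: "`Ш_BK(E, A) = Sel(E, A)/Sel(E, A)_div` … is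
finite"; for `E`, `Ш_AJ(K_n, A) = Ш(E/K_n)[p^∞]` and `Ш_BK = Ш(E/K_n)[p^∞]/div`, flag `LMZ-T`), on the
tree's `WeierstrassCurve.sha` of the base change to `K_n`.
[cite: LeiMastellaZhao2025, Thm. B (III), Def. 3.3, Def. 3.5 (arXiv:2409.11966v2 pp. 7–8, 18)] -/
def LayerShaPrimaryFinite (n : ℕ) : Prop :=
  haveI : FiniteDimensional K (κ.layer n) := κ.finiteDimensional_layer_holds n
  haveI : NumberField (κ.layer n) := NumberField.of_module_finite K (κ.layer n)
  Set.Finite {x : (W.baseChange (κ.layer n)).sha | ∃ k : ℕ, p ^ k • x = 0}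

/-- **"`Ш_AJ(K_n, A) = 0`" read for `E`: `Ш(E/K_n)[p^∞] = 0`** — no non-zero class of `Ш(E/K_n)` is
killed by a power of `p` (LMZ Thm. B (V); for `E`, `Ш_AJ(K_n, A) = Sel_{p^∞}(E/K_n)/(E(K_n) ⊗ ℚ_p/ℤ_p) =
Ш(E/K_n)[p^∞]`, flag `LMZ-T`; the currency of `MatarNekovar2019.thm67_sha_primary_trivial_of_irreducible`
at `n = 0`). [cite: LeiMastellaZhao2025, Thm. B (V) and Def. 3.5 (arXiv:2409.11966v2 pp. 8, 18)] -/
def LayerShaPrimaryTrivial (n : ℕ) : Prop :=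
  haveI : FiniteDimensional K (κ.layer n) := κ.finiteDimensional_layer_holds n
  haveI : NumberField (κ.layer n) := NumberField.of_module_finite K (κ.layer n)
  ∀ (x : (W.baseChange (κ.layer n)).sha) (k : ℕ), p ^ k • x = 0 → x = 0

end Hypotheses

/-! ## Part 2. The theorems (named facts, statements only; hypotheses as printed, read for `f = f_E`) -/

section Facts

variable (W : WeierstrassCurve ℚ) [W.IsGloballyMinimal] (K : Type) [Field K] [NumberField K]
  (p : ℕ) [Fact p.Prime] (κ : ZpExtension K p) (𝔭 𝔭' : HeightOneSpectrum (𝓞 K))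

/-- **Lei–Mastella–Zhao 2025, Theorem B (I)–(III) (Appendix A; after Matar, Acta Arith. 201 (2021)),
read for `f = f_E`: in the Gross setting at an ODD supersingular prime with `a_p = 0`, both signed
Selmer groups `Sel^±(E/K_∞)` over the anticyclotomic tower are COFREE OF CORANK ONE over `Λ`,
`corank_{ℤ_p} Sel_{p^∞}(E/K_n) = p^n` and `Ш(E/K_n)[p^∞]` is finite for every `n`.** Printed (arXiv v2,
App. A): "Theorem B. Let `f` be a normalized cuspidal eigen-newform of even weight `k` and level `Γ₀(N)`.
Let `K` be an imaginary quadratic field with coprime-to-`Np` discriminant `d_K ≠ −3, −4` and satisfying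
(Heeg.). Assume moreover `N ≥ 5` if `N⁻ = 1`, and `N⁺ > 3` and `k ≥ 4` if `N⁻ ≠ 1`. Let `p` be a prime
such that: (i) `p` splits in `K`, and does not divide the class number `h_K`; (ii') `p ∤ 2(k−1)!Nφ(N)`;
(iii') `a_p(f) = 0`; (iv) For any `w ∣ N` in `K` and any `w' ∣ w` in `K_∞`, the group `A^{G_{K_∞,w'}}` is
divisible; (v') The class `z_{f,K}` is globally primitive, i.e., `z_{f,K} ∉ ϖH¹(K, T)`. Moreover,
`pα₁ ≠ …α₀` and `pα₂ ≠ −p^{k−2}α₀`; (vi) `Sel(K, A) ≃ 𝔽/𝒪 · z_{f,K}`; (vii) `p` is unramified in `𝔽`.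
Then: (I) the Selmer modules `Sel^+(K_∞, A)` and `Sel^−(K_∞, A)`, whose definitions are recalled in
§A.2.4, are cofree of corank one over `Λ`; (II) for all `n ≥ 0`, `corank_𝒪(Sel(K_n/A)) = p^n`; (III) the
Shafarevich–Tate groups `Ш_BK(K_n, A)` and `Ш_AJ(K_n, A)` introduced in §3 coincide. In particular,
`Ш_AJ(K_n, A)` is finite for all `n ≥ 0`." Remark A.1 (4): "if `k = 2`, then the conditions on `α₁, α₂`
are superfluous". (I) = Prop. A.16 ("The `Λ`-modules `X^±_∞` are free of rank 1") with Prop. A.9.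
TRANSCRIBED at `k = 2` for `E/ℚ` elliptic of conductor `N` (`Setting`: globally minimal model `W`, `p`
odd, good supersingular with `a_p = 0` = (iii'), `K` imaginary quadratic, `p = 𝔭𝔭'` split and `p ∤ h_K`
= (i), `κ` anticyclotomic; (vii) void), `N⁻ = 1` (every prime dividing `N` splits,
`SatisfiesHeegnerHypothesis`; `5 ≤ N`), `d_K ≠ −3, −4` (flag `coprime-disc`), (ii') as
`p ∤ 2·N·φ(N)` (`(k−1)! = 1`), (iv) as `LocalTorsionDivisibleAtBad`, and (v')/(vi) on a Heegner point
`P = y_K ∈ E(K)` of level `N` (`IsHeegnerPoint`) as `P ∉ pE(K)`, `rank_ℤ E(K) = 1`, `Ш(E/K)[p^∞] = 0`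
(flag `LMZ-z`). CONCLUSIONS: (I) on every Pontryagin-dual datum of `Sel^ε(E/K_∞) =
Kobayashi2003.signedSelmerInfty (W⁄K) κ ε` (flag `LMZ-local-condition`), for every topological
generator `γ` (`Λ = ℤ_p⟦T⟧`, `T = γ − 1`) and each sign `ε`: `X^ε` finitely generated, FREE, of `finrank`
one; (II) `LayerSelmerCorankEq … n (p^n)`; (III) `LayerShaPrimaryFinite … n` (flag `LMZ-T`). At `p = 3`
the printed conditions read `3 ∤ N φ(N) h_K`, `d_K ≠ −3, −4`. Size XL (Kobayashi/Lei `±`-theory over the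
tower, generalized Heegner modules, Prop. A.13–A.16); no `_holds`.
[cite: LeiMastellaZhao2025, Thm. B (I)–(III), Remark A.1, Prop. A.9, Prop. A.16, §A.4 (arXiv:2409.11966v2 pp. 18–26)]
[cite: KleineMatarRamdorai2026, Thm. 2.11 (restating Matar2021ActaArith; standing p ≥ 5)]
[cite: Matar2021ActaArith] -/
def leiMastellaZhao2025_thmB : Prop :=
  ∀ (_ : Setting W K p κ 𝔭 𝔭') (N : ℕ) [NeZero N], (W.conductorNorm ℤ : ℕ) = N → 5 ≤ N →
    SatisfiesHeegnerHypothesis N K → NumberField.discr K ≠ -3 → NumberField.discr K ≠ -4 →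
    -- (ii') at `k = 2`: `p ∤ 2·(k−1)!·N·φ(N) = 2Nφ(N)`
    ¬ p ∣ 2 * N * Nat.totient N →
    -- (iv) = (Tama.)
    LocalTorsionDivisibleAtBad W K p κ N →
    -- (v') and (vi), read on the Heegner point `y_K = P`
    ∀ (P : (W.baseChange K).toAffine.Point), IsHeegnerPoint N W K P →
      (¬ ∃ Q : (W.baseChange K).toAffine.Point, p • Q = P) →
      (W.baseChange K).mordellWeilRank = 1 →
      (∀ (x : (W.baseChange K).sha) (k : ℕ), p ^ k • x = 0 → x = 0) →
    -- (I) `X^+` and `X^−` free of rank one over `Λ`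
    (∀ (γ : absoluteGaloisGroup K), κ.IsTopGenerator γ → ∀ (ε : ℤˣ)
        (D : SignedSelmerDualData (W.baseChange K) κ γ ε),
        Module.Finite (IwasawaAlgebra p) D.X ∧ Module.Free (IwasawaAlgebra p) D.X ∧
          Module.finrank (IwasawaAlgebra p) D.X = 1) ∧
    -- (II) and (III), layer by layer
    (∀ n : ℕ, LayerSelmerCorankEq W K p κ n (p ^ n) ∧ LayerShaPrimaryFinite W K p κ n)

/-- **Lei–Mastella–Zhao 2025, Theorem B (IV)–(V) (Appendix A; after Matar 2021), read for `f = f_E`: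
if in addition the Heegner point is not divisible by `p` LOCALLY at `v ∣ p`, then the Pontryagin dual
`X(E/K_∞)` of `Sel_{p^∞}(E/K_∞)` is FREE OF RANK TWO over `Λ` and `Ш(E/K_n)[p^∞] = 0` for every
`n`.** Printed (continuing Theorem B): "Suppose in addition that `loc_v(z_{f,K}) ∉ ϖH¹_f(K_v, T)`, then
we have (IV) `Sel(K_∞, A)^∨` is free of rank 2 over `Λ`; (V) `Ш_AJ(K_n, A) = 0` for all
`n ∈ ℤ_{≥0} ∪ {∞}`" (§A.4, "Proof of Theorem B, part 2": (V) from Cor. 5.4 (2) and (III); (IV) from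
Remark 5.2 (ii) and Cor. A.12); LMZ §1.2: "Matar [Mat21a; Mat21b] … show[ed] that the `p`-primary
Shafarevich–Tate groups of `E` in the anticyclotomic `ℤ_p`-tower are once again trivial, whereas the
Pontryagin dual of `Sel_{p^∞}(E/K_∞)` is a free `Λ`-module of rank two". TRANSCRIBED with the binders of
`leiMastellaZhao2025_thmB` plus (Loc.prim.) at `𝔭` as `HeegnerPointLocallyIndivisible` (flag `LMZ-z`);
(IV) on every Pontryagin-dual datum `WeierstrassCurve.SelmerDualData (W⁄K) κ γ` of `Sel_{p^∞}(E/K_∞) =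
selmerInfty` (finitely generated, FREE, `finrank` two over `Λ = ℤ_p⟦T⟧`); (V) as
`LayerShaPrimaryTrivial … n` for every FINITE `n` (flag `n = ∞ only`, here: `n = ∞` dropped — weaker
than print). Size XL; no `_holds`.
[cite: LeiMastellaZhao2025, Thm. B (IV)–(V) and §A.4 (arXiv:2409.11966v2 pp. 18, 25–26)]
[cite: Matar2021ActaArith] [cite: Matar2021RNT] -/
def leiMastellaZhao2025_thmB_locPrim : Prop :=
  ∀ (_ : Setting W K p κ 𝔭 𝔭') (N : ℕ) [NeZero N], (W.conductorNorm ℤ : ℕ) = N → 5 ≤ N →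
    SatisfiesHeegnerHypothesis N K → NumberField.discr K ≠ -3 → NumberField.discr K ≠ -4 →
    ¬ p ∣ 2 * N * Nat.totient N →
    LocalTorsionDivisibleAtBad W K p κ N →
    ∀ (P : (W.baseChange K).toAffine.Point), IsHeegnerPoint N W K P →
      (¬ ∃ Q : (W.baseChange K).toAffine.Point, p • Q = P) →
      (W.baseChange K).mordellWeilRank = 1 →
      (∀ (x : (W.baseChange K).sha) (k : ℕ), p ^ k • x = 0 → x = 0) →
      -- the extra hypothesis: (Loc.prim.) at `v = 𝔭`
      HeegnerPointLocallyIndivisible W K p 𝔭 P →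
    -- (IV) `X(E/K_∞)` free of rank two over `Λ`
    (∀ (γ : absoluteGaloisGroup K), κ.IsTopGenerator γ →
        ∀ (D : WeierstrassCurve.SelmerDualData (W.baseChange K) κ γ),
        Module.Finite (IwasawaAlgebra p) D.X ∧ Module.Free (IwasawaAlgebra p) D.X ∧
          Module.finrank (IwasawaAlgebra p) D.X = 2) ∧
    -- (V) `Ш(E/K_n)[p^∞] = 0` for all `n`
    (∀ n : ℕ, LayerShaPrimaryTrivial W K p κ n)

/-- **Lei–Mastella–Zhao 2025, Theorem A (= Prop. 5.1 + Cor. 5.4 + Thm. 6.2) in the NON-ORDINARY case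
`a_p = 0`, read for `f = f_E`: under local primitivity of the Heegner point at `v ∣ p`, the BDP
(relaxed–strict) Selmer groups over the anticyclotomic tower VANISH, `Sel_{p^∞}(E/K_n) ≅ (ℚ_p/ℤ_p)^{p^n}`
for every `n`, and `X(E/K_∞)` is free of rank two over `Λ`.** Printed (arXiv v2 §1.3): "Theorem A.
Let `f` be a normalized cuspidal eigen-newform of even weight `k` and level `Γ₀(N)`. Let `K` be an
imaginary quadratic field with coprime-to-`Np` discriminant `d_K ≠ −3, −4` and satisfying (Heeg.).
Assume moreover `N ≥ 5` if `N⁻ = 1`, and `N⁺ > 3` and `k ≥ 4` if `N⁻ ≠ 1`. Let `p` be a prime such that: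
(i) `p` splits in `K`, and does not divide the class number `h_K`; (ii) `p ∤ 2(k−2)!Nφ(N)`; (iii) if `f`
has weight 2 and is `p`-ordinary, then `a_p ≢ 1 (mod ϖ)`; (iv) for any `w ∣ N` in `K` and any `w' ∣ w`
in `K_∞`, the group `A^{G_{K_∞,w'}}` is divisible; (v) the class `z_{f,K}` is locally primitive at `v`,
i.e., its restriction `loc_v(z_{f,K}) ∈ H¹_f(K_v, T)` is not in `ϖH¹_f(K_v, T)`; (vi) `Sel(K, A) =
𝔽/𝒪 · z_{f,K}`. Then we have: (1) for `n ∈ ℤ_{≥0} ∪ {∞}`, the relaxed-strict (or BDP) Selmer group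
`Sel^{∅,0}(K_n, A)` is trivial; (2) for `n ∈ ℤ_{≥0}`, `Sel(K_n, A) ≃ (𝔽/𝒪)^{⊕p^n}`; (3) the Pontryagin
dual `Sel(K_∞, A)^∨` is a free `Λ`-module of rank one (resp. two) if `f` is ordinary (resp.
non-ordinary) at `p`"; Remark 5.2: "(i) `Sel(K, A) → H¹_f(K_v̄, A)` is an isomorphism … our proof works
with `v, v̄` switched under the same set of assumptions"; and (v2, after Remark 1.1): "the proof of
Theorem A … does not employ the generalized Heegner class in an essential way. Rather, we rely on the
existence of a cohomology class `z ∈ H¹_f(K, T)` for which … (v) and (vi) … are met … Theorem A holds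
when `z_{f,K}` is replaced by the classical Heegner class". TRANSCRIBED at `k = 2`, `a_p = 0`
(non-ordinary; (iii) void) in the `Setting`, with `N⁻ = 1`, `5 ≤ N`, `d_K ≠ −3, −4`, (ii) as
`p ∤ 2·N·φ(N)` (`(k−2)! = 1`), (iv) as `LocalTorsionDivisibleAtBad`, (v) at `v = 𝔭` as
`HeegnerPointLocallyIndivisible`, (vi) as `rank_ℤ E(K) = 1 ∧ Ш(E/K)[p^∞] = 0` for the Heegner point `P`
(flag `LMZ-z` — covered by print for this theorem). CONCLUSIONS: (1) at `n = ∞` ONLY (flag), in the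
`K_∞`-formulation of `AnticyclotomicSignedSelmer.lean`: the groups `Sel^{rel,str}` and `Sel^{str,rel}`
— strict at one prime above `p`, relaxed at the other, strict away from `p` (flag `away-p`) — are `⊥`
(both orders, Remark 5.2); (2) `LayerSelmerCorankEq … n (p^n) ∧ LayerSelmerDivisible … n`; (3) rank TWO:
every `WeierstrassCurve.SelmerDualData (W⁄K) κ γ` is finitely generated, free, of `finrank` two. Bridge to
the crux currency: `leiMastellaZhao2025_thmA_apZero.selmerAc_eq_bot`. Size XL; no `_holds`.
[cite: LeiMastellaZhao2025, Thm. A, Prop. 5.1, Remark 5.2, Cor. 5.4, Thm. 6.2 (arXiv:2409.11966v2 pp. 2–3, 13–17)]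
[cite: Matar2021ActaArith] [cite: Matar2021RNT] -/
def leiMastellaZhao2025_thmA_apZero : Prop :=
  ∀ (_ : Setting W K p κ 𝔭 𝔭') (N : ℕ) [NeZero N], (W.conductorNorm ℤ : ℕ) = N → 5 ≤ N →
    SatisfiesHeegnerHypothesis N K → NumberField.discr K ≠ -3 → NumberField.discr K ≠ -4 →
    -- (ii) at `k = 2`: `p ∤ 2·(k−2)!·N·φ(N) = 2Nφ(N)`
    ¬ p ∣ 2 * N * Nat.totient N →
    -- (iv) = (Tama.)
    LocalTorsionDivisibleAtBad W K p κ N →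
    -- (v) = (Loc.prim.) at `v = 𝔭` and (vi) = (Sel.), read on the Heegner point `y_K = P`
    ∀ (P : (W.baseChange K).toAffine.Point), IsHeegnerPoint N W K P →
      HeegnerPointLocallyIndivisible W K p 𝔭 P →
      (W.baseChange K).mordellWeilRank = 1 →
      (∀ (x : (W.baseChange K).sha) (k : ℕ), p ^ k • x = 0 → x = 0) →
    -- (1) at `n = ∞`: `Sel^{rel at 𝔭, str at 𝔭'}(K_∞, E[p^∞]) = 0 = Sel^{str at 𝔭, rel at 𝔭'}(K_∞, E[p^∞])`
    selmer (W.baseChange K) p κ ∅ (PCond.at 𝔭' .str .rel) = ⊥ ∧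
    selmer (W.baseChange K) p κ ∅ (PCond.at 𝔭 .str .rel) = ⊥ ∧
    -- (2) `Sel_{p^∞}(E/K_n) ≅ (ℚ_p/ℤ_p)^{p^n}`
    (∀ n : ℕ, LayerSelmerCorankEq W K p κ n (p ^ n) ∧ LayerSelmerDivisible W K p κ n) ∧
    -- (3) non-ordinary: `X(E/K_∞)` free of rank two over `Λ`
    (∀ (γ : absoluteGaloisGroup K), κ.IsTopGenerator γ →
        ∀ (D : WeierstrassCurve.SelmerDualData (W.baseChange K) κ γ),
        Module.Finite (IwasawaAlgebra p) D.X ∧ Module.Free (IwasawaAlgebra p) D.X ∧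
          Module.finrank (IwasawaAlgebra p) D.X = 2)

end Facts

/-! ## Part 3. Proved bridges (kernel-checked; the facts enter as hypotheses; 0 further facts) -/

section Bridges

variable {W : WeierstrassCurve ℚ} [W.IsGloballyMinimal] {K : Type} [Field K] [NumberField K]
  {p : ℕ} [Fact p.Prime] {κ : ZpExtension K p} {𝔭 𝔭' : HeightOneSpectrum (𝓞 K)}

/-- **The `hrk` input of Hatley–Lei–Vigni at `p` odd (hence at `p = 3`) from LMZ Theorem B (I)**: in
the Gross setting, every Pontryagin-dual datum `X^ε` of `Sel^ε(E/K_∞)` is finitely generated of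
`finrank` one over `Λ` — exactly the shape of the binder `hrk` of
`hatleyLeiVigni2022_thm515_noFiniteIndex` / `hatleyLeiVigni2022_thm63_invariants_congruent` (flag
`HLV-rank-one-input` of `AnticyclotomicSignedSelmerFiniteIndex.lean`), obtained by dropping freeness.
[cite: LeiMastellaZhao2025, Thm. B (I) and Prop. A.16 (arXiv:2409.11966v2 pp. 18, 25)] -/
theorem leiMastellaZhao2025_thmB.hrk (h : leiMastellaZhao2025_thmB W K p κ 𝔭 𝔭')
    (hS : Setting W K p κ 𝔭 𝔭') {N : ℕ} [NeZero N] (hN : (W.conductorNorm ℤ : ℕ) = N) (h5 : 5 ≤ N)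
    (hH : SatisfiesHeegnerHypothesis N K) (hD3 : NumberField.discr K ≠ -3)
    (hD4 : NumberField.discr K ≠ -4) (hii : ¬ p ∣ 2 * N * Nat.totient N)
    (hiv : LocalTorsionDivisibleAtBad W K p κ N) {P : (W.baseChange K).toAffine.Point}
    (hP : IsHeegnerPoint N W K P) (hdiv : ¬ ∃ Q : (W.baseChange K).toAffine.Point, p • Q = P)
    (hrk : (W.baseChange K).mordellWeilRank = 1)
    (hSha : ∀ (x : (W.baseChange K).sha) (k : ℕ), p ^ k • x = 0 → x = 0)
    {γ : absoluteGaloisGroup K} (hγ : κ.IsTopGenerator γ) (ε : ℤˣ)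
    (D : SignedSelmerDualData (W.baseChange K) κ γ ε) :
    Module.Finite (IwasawaAlgebra p) D.X ∧ Module.finrank (IwasawaAlgebra p) D.X = 1 := by
  obtain ⟨hI, -⟩ := h hS N hN h5 hH hD3 hD4 hii hiv P hP hdiv hrk hSha
  obtain ⟨hfin, -, hrank⟩ := hI γ hγ ε D
  exact ⟨hfin, hrank⟩

/-- **LMZ Theorem B (I) gives `X^ε ≃ₗ[Λ] Λ`**: a finitely generated free module of `finrank` one over
the commutative ring `Λ = ℤ_p⟦T⟧` is isomorphic to `Λ` (Mathlib: free modules of equal `finrank` are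
isomorphic). [cite: LeiMastellaZhao2025, Thm. B (I) and Prop. A.16 (arXiv:2409.11966v2 pp. 18, 25)] -/
theorem leiMastellaZhao2025_thmB.nonempty_linearEquiv (h : leiMastellaZhao2025_thmB W K p κ 𝔭 𝔭')
    (hS : Setting W K p κ 𝔭 𝔭') {N : ℕ} [NeZero N] (hN : (W.conductorNorm ℤ : ℕ) = N) (h5 : 5 ≤ N)
    (hH : SatisfiesHeegnerHypothesis N K) (hD3 : NumberField.discr K ≠ -3)
    (hD4 : NumberField.discr K ≠ -4) (hii : ¬ p ∣ 2 * N * Nat.totient N)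
    (hiv : LocalTorsionDivisibleAtBad W K p κ N) {P : (W.baseChange K).toAffine.Point}
    (hP : IsHeegnerPoint N W K P) (hdiv : ¬ ∃ Q : (W.baseChange K).toAffine.Point, p • Q = P)
    (hrk : (W.baseChange K).mordellWeilRank = 1)
    (hSha : ∀ (x : (W.baseChange K).sha) (k : ℕ), p ^ k • x = 0 → x = 0)
    {γ : absoluteGaloisGroup K} (hγ : κ.IsTopGenerator γ) (ε : ℤˣ)
    (D : SignedSelmerDualData (W.baseChange K) κ γ ε) :
    Nonempty (D.X ≃ₗ[IwasawaAlgebra p] IwasawaAlgebra p) := by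
  obtain ⟨hI, -⟩ := h hS N hN h5 hH hD3 hD4 hii hiv P hP hdiv hrk hSha
  obtain ⟨hfin, hfree, hrank⟩ := hI γ hγ ε D
  haveI := hfin
  haveI := hfree
  refine ⟨LinearEquiv.ofFinrankEq D.X (IwasawaAlgebra p) ?_⟩
  rw [hrank, Module.finrank_self]

/-- **LMZ Theorem A (1) in the tree's anticyclotomic-Selmer currency**: in the locally primitive Gross
setting the anticyclotomic Selmer group `Castella2018.AcSelmer.selmerAc (W⁄K) p κ 𝔮 ∅` (strict above
`𝔮`, relaxed above the other prime over `p`, strict away from `p`) — whose `Λ`-dual `AcSelmer.XAc`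
carries the BDP-type main conjectures of the tree — is TRIVIAL for both `𝔮 = 𝔭'` and `𝔮 = 𝔭`
(`selmer_at_str_rel_eq_selmerAc`). [cite: LeiMastellaZhao2025, Thm. A (1), Prop. 5.1, Remark 5.2 (arXiv:2409.11966v2 pp. 2, 13–14)] -/
theorem leiMastellaZhao2025_thmA_apZero.selmerAc_eq_bot
    (h : leiMastellaZhao2025_thmA_apZero W K p κ 𝔭 𝔭')
    (hS : Setting W K p κ 𝔭 𝔭') {N : ℕ} [NeZero N] (hN : (W.conductorNorm ℤ : ℕ) = N) (h5 : 5 ≤ N)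
    (hH : SatisfiesHeegnerHypothesis N K) (hD3 : NumberField.discr K ≠ -3)
    (hD4 : NumberField.discr K ≠ -4) (hii : ¬ p ∣ 2 * N * Nat.totient N)
    (hiv : LocalTorsionDivisibleAtBad W K p κ N) {P : (W.baseChange K).toAffine.Point}
    (hP : IsHeegnerPoint N W K P) (hloc : HeegnerPointLocallyIndivisible W K p 𝔭 P)
    (hrk : (W.baseChange K).mordellWeilRank = 1)
    (hSha : ∀ (x : (W.baseChange K).sha) (k : ℕ), p ^ k • x = 0 → x = 0) :
    Castella2018.AcSelmer.selmerAc (W.baseChange K) p κ 𝔭' ∅ = ⊥ ∧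
      Castella2018.AcSelmer.selmerAc (W.baseChange K) p κ 𝔭 ∅ = ⊥ := by
  obtain ⟨h1, h1', -⟩ := h hS N hN h5 hH hD3 hD4 hii hiv P hP hloc hrk hSha
  rw [selmer_at_str_rel_eq_selmerAc (W := W.baseChange K) ∅ hS.mem'] at h1
  rw [selmer_at_str_rel_eq_selmerAc (W := W.baseChange K) ∅ hS.mem] at h1'
  exact ⟨h1, h1'⟩

/-- **LMZ Theorem A (2) ⟹ the corank growth of Theorem B (II)** (same conclusion shape; bookkeeping
projection for consumers that hold the locally primitive fact only).
[cite: LeiMastellaZhao2025, Thm. A (2) and Cor. 5.4 (1) (arXiv:2409.11966v2 pp. 2, 15)] -/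
theorem leiMastellaZhao2025_thmA_apZero.layerSelmerCorankEq
    (h : leiMastellaZhao2025_thmA_apZero W K p κ 𝔭 𝔭')
    (hS : Setting W K p κ 𝔭 𝔭') {N : ℕ} [NeZero N] (hN : (W.conductorNorm ℤ : ℕ) = N) (h5 : 5 ≤ N)
    (hH : SatisfiesHeegnerHypothesis N K) (hD3 : NumberField.discr K ≠ -3)
    (hD4 : NumberField.discr K ≠ -4) (hii : ¬ p ∣ 2 * N * Nat.totient N)
    (hiv : LocalTorsionDivisibleAtBad W K p κ N) {P : (W.baseChange K).toAffine.Point}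
    (hP : IsHeegnerPoint N W K P) (hloc : HeegnerPointLocallyIndivisible W K p 𝔭 P)
    (hrk : (W.baseChange K).mordellWeilRank = 1)
    (hSha : ∀ (x : (W.baseChange K).sha) (k : ℕ), p ^ k • x = 0 → x = 0) (n : ℕ) :
    LayerSelmerCorankEq W K p κ n (p ^ n) := by
  obtain ⟨-, -, h2, -⟩ := h hS N hN h5 hH hD3 hD4 hii hiv P hP hloc hrk hSha
  exact (h2 n).1

end Bridges

end Literature.NumberTheory.EllipticCurves.AcSigned

end
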